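import Summits.ResolutionOfSingularities.ResolutionOfSingularities.Theorems.EquisingularLiftEquisingularLiftNatCechShadowChartAlgebra
import Summits.ResolutionOfSingularities.ResolutionOfSingularities.Theorems.EquisingularLiftEquisingularLiftNatCechShadowRing
import Summits.ResolutionOfSingularities.ResolutionOfSingularities.Theorems.EquisingularLiftCampaignW45bBlowupStalkDictionary
import Summits.ResolutionOfSingularities.ResolutionOfSingularities.Theorems.EquisingularLiftEquisingularLiftNatCarrierDeltaStalks
import Literature.AlgebraicGeometry.Resolution.BlowupAlgebraQuasiRegularChart
import Literature.AlgebraicGeometry.Resolution.RegularQuotientIdeal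
import Literature.AlgebraicGeometry.Resolution.StrictTransformBaseChange
import Literature.AlgebraicGeometry.Resolution.CanonicalResolutionSmoothCentre
import Literature.AlgebraicGeometry.Resolution.BlowupChartMembership
import Literature.AlgebraicGeometry.Resolution.RegularBlowup
import Literature.AlgebraicGeometry.Resolution.BlowupSNC
import Literature.AlgebraicGeometry.Resolution.AdicCompletionRegular
import HarnessLib

/-!
# [OURS · L1 W4.5(b) · EL♮(3)] THE KEY LOCAL FACT OF THE ČECH SHADOW AT A POINT OF THE NEW EXCEPTIONAL SURFACE
# (`St_𝒞 𝒦 = 𝒦·𝒪_{X₂}` at `y₂`, the regular triple `(ϖ, w, f*)` in all orders, and the `n = 3` conditional regularity of `V(w, f*)`)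

Crux chain w45b (cell `res-hironaka`, slot W4.5(b)), working crux **EL♮** = stmt-ResolutionOfSingularities-20038, child **EL♮(3)** =
stmt-ResolutionOfSingularities-20148, route EquisingularLift, line `sections`; registered stub `stub_elnat_coneTowerPointResolution` @ `ReachTower₄`,
stand-in S6 `hCech`, sub-stand-ins (N3) `hShadow` / (N3′) `hShadowOld` of `Tower.hCech₃_of_lift_sec` (res-L1-w45b-stub-4 p576661) / `…_kiv`.
Written by res-L1-w45b-stub-2 g8 (res-L1-w45b-plan-1 RULING OF RECORD 2026-08-27T22:17:09Z). HONEST FRAMING: OURS; NOT a statement of any manuscript;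
AI-written, weaker than expert review. No `sorry`; standard axioms; DEF-FREE. `--supports stmt-ResolutionOfSingularities-20148 --as helper`.

WHAT. `X` regular locally Noetherian, `𝒞` an ideal sheaf with `V(𝒞)` regular, `τ : X₂ → X` the blow-up along `𝒞`, `𝒦` an ideal sheaf with `𝒦_x = (f)`
at `x = τ y₂ ∈ V(𝒞)`, and an element `ϖ ∈ 𝒪_{X,x}` (the uniformiser germ in the application) such that (G1) `f` is a nonzerodivisor modulo `𝒞_x + (ϖ)`
(…NatCechShadowTrace: «off the shadow»), `ϖ` is a nonzerodivisor modulo `𝒞_x` (flatness of `V(𝒞)`), and `𝒞_x + (ϖ) ≠ ⊤`. Writing `R = 𝒪_{X₂,y₂}`, `w` for a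
generator of the exceptional ideal `(𝒞·𝒪_{X₂})_{y₂}`, `f* = τ♯ f`, `ϖ₂ = τ♯ ϖ`:
* **`exists_generator_cechShadow_local`** — ∃ such a `w` with
  (a) `(St_𝒞 𝒦)_{y₂} = (f*)` (total transform = strict transform: trivial saturation, `w` a nonzerodivisor mod `f*`);
  (b) `w` is a nonzerodivisor modulo `(f*) + (ϖ₂)` (downstairs: the exceptional equation is regular modulo the transported shadow);
  (c) `ϖ₂` is a nonzerodivisor modulo `(w) + (f*)` (the new pair `V(w, f*)` is `O`-flat at `y₂`);
  (d) for `dim 𝒪_{X,x}/𝒞_x ≤ 2` and `f ∈ 𝔪_x`: if `R/((w) + ((ϖ₂) + (f*)))` is REDUCED then `R/((w) + (f*))` is a regular local ring (the `n = 3` step).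
  PROOF: the stalk dictionary (…W45bBlowupStalkDictionary p506193) presents `R` as a localisation at a prime over `𝔪_x` of the chart algebra `𝒪_{X,x}[I/c_j]` of a
  quasi-regular frame `c` of `𝒞_x` (`exists_isQuasiRegular_span_eq_of_isRegularLocalRing_quotient`); modulo `w = c_j/1` this is the flat local
  `(𝒪_{X,x}/𝒞_x)`-algebra of …NatCechShadowChartAlgebra (Stacks 0BIQ), so nonzerodivisors ascend from `𝒪_{X,x}/𝒞_x` and its quotient by `ϖ`,
  reducedness descends, regularity ascends; the three swaps are …NatCechShadowRing `mul_mem_sup_of_swap`; (d) is …NatCechShadowRing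
  `isRegularLocalRing_quotient_span_of_isReduced` on `Abar = 𝒪_{X,x}/𝒞_x`.

References (index only): [cite: StacksProject, Tag 0BIQ]; [cite: Liu2002, Thm. 8.1.19]; [cite: Matsumura1987, Thm. 14.2 and §16]; res-L1-w45b-lead-2
STATUS 2026-08-27T21:14:43Z (route (γ): `𝒦₂ := 𝒦·𝒪_{X₂}`, steps (i)–(v)).
-/

set_option linter.dupNamespace false -- mandated namespace `Summit.<Summit>.<Problem>` of this single-conjunct summit

noncomputable section

open CategoryTheory AlgebraicGeometry TopologicalSpace IsLocalRing
open Literature.AlgebraicGeometry.Resolution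
open AlgebraicGeometry.Scheme.IdealSheafData

namespace Summit.ResolutionOfSingularities.ResolutionOfSingularities.Cruxes.EquisingularLiftNat.Sections.CechShadow

set_option maxHeartbeats 800000 in -- chart algebra `blowupAlgebra` = subalgebra of a localisation: slow unification (as p509910 / p535712)
/-- **The key local fact of the Čech shadow at a point of the new exceptional surface** (see the module docstring for (a)–(d)).
[cite: StacksProject, Tag 0BIQ] [cite: Matsumura1987, Thm. 14.2 and §16] [OURS · L1 W4.5b] (N3)/(N3′) of TOWER₄ S6 toward
`stub_elnat_coneTowerPointResolution` (stmt-ResolutionOfSingularities-20148 / -20038); NOT a statement of the manuscript. -/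
theorem exists_generator_cechShadow_local {X X₂ : Scheme.{0}} [IsLocallyNoetherian X] [IsLocallyNoetherian X₂]
    {τ : X₂ ⟶ X} {𝒞 : X.IdealSheafData} (hXreg : Scheme.IsRegular X) (hCreg : Scheme.IsRegular 𝒞.subscheme) (hτ : IsBlowup τ 𝒞)
    (𝒦 : X.IdealSheafData) (y₂ : X₂) (hy : τ y₂ ∈ 𝒞.support) (f ϖ : X.presheaf.stalk (τ y₂))
    (hf : stalkIdeal 𝒦 (τ y₂) = Ideal.span {f})
    (hG1 : ∀ a, f * a ∈ stalkIdeal 𝒞 (τ y₂) ⊔ Ideal.span {ϖ} → a ∈ stalkIdeal 𝒞 (τ y₂) ⊔ Ideal.span {ϖ})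
    (hϖ : ∀ a, ϖ * a ∈ stalkIdeal 𝒞 (τ y₂) → a ∈ stalkIdeal 𝒞 (τ y₂))
    (hne : stalkIdeal 𝒞 (τ y₂) ⊔ Ideal.span {ϖ} ≠ ⊤) :
    ∃ w : X₂.presheaf.stalk y₂, stalkIdeal (𝒞.comap τ) y₂ = Ideal.span {w} ∧
      stalkIdeal (strictTransformIdeal τ 𝒞 𝒦) y₂ = Ideal.span {(τ.stalkMap y₂).hom f} ∧
      (∀ z, w * z ∈ Ideal.span {(τ.stalkMap y₂).hom f} ⊔ Ideal.span {(τ.stalkMap y₂).hom ϖ} →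
        z ∈ Ideal.span {(τ.stalkMap y₂).hom f} ⊔ Ideal.span {(τ.stalkMap y₂).hom ϖ}) ∧
      (∀ z, (τ.stalkMap y₂).hom ϖ * z ∈ Ideal.span {w} ⊔ Ideal.span {(τ.stalkMap y₂).hom f} →
        z ∈ Ideal.span {w} ⊔ Ideal.span {(τ.stalkMap y₂).hom f}) ∧
      (ringKrullDim (X.presheaf.stalk (τ y₂) ⧸ stalkIdeal 𝒞 (τ y₂)) ≤ 2 → f ∈ maximalIdeal (X.presheaf.stalk (τ y₂)) →
        IsReduced (X₂.presheaf.stalk y₂ ⧸ (Ideal.span {w} ⊔ (Ideal.span {(τ.stalkMap y₂).hom ϖ} ⊔ Ideal.span {(τ.stalkMap y₂).hom f}))) →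
        IsRegularLocalRing (X₂.presheaf.stalk y₂ ⧸ (Ideal.span {w} ⊔ Ideal.span {(τ.stalkMap y₂).hom f}))) := by
  classical
  -- the rings `A = 𝒪_{X,x}`, `R = 𝒪_{X₂,y₂}`, the centre stalk `I`
  haveI hA : IsRegularLocalRing (X.presheaf.stalk (τ y₂)) := hXreg _
  have hreg₂ : Scheme.IsRegular X₂ := hτ.isRegular_of_isRegular_subscheme hXreg hCreg
  haveI hR : IsRegularLocalRing (X₂.presheaf.stalk y₂) := hreg₂ _
  haveI : IsDomain (X₂.presheaf.stalk y₂) := isDomain_of_isRegularLocalRing _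
  set I := stalkIdeal 𝒞 (τ y₂) with hIdef
  have hIm : I ≤ maximalIdeal _ := (mem_support_iff_stalkIdeal_le _ _).mp hy
  have hItop : I ≠ ⊤ := fun h => (maximalIdeal.isMaximal _).ne_top (top_le_iff.mp (h ▸ hIm))
  haveI hAI : IsRegularLocalRing (X.presheaf.stalk (τ y₂) ⧸ I) := isRegularLocalRing_stalk_quotient_stalkIdeal hCreg hy
  have hIprime : I.IsPrime := isPrime_stalkIdeal_of_isRegular_subscheme hCreg hy
  -- elementary consequences of (G1), `hϖ`, `hne`
  have hfI : f ∉ I := by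
    intro h
    apply hne
    rw [Ideal.eq_top_iff_one]
    exact hG1 1 (by rw [mul_one]; exact Ideal.mem_sup_left h)
  have hfregI : ∀ a, f * a ∈ I → a ∈ I := fun a ha => (hIprime.mem_or_mem ha).resolve_left hfI
  have hϖI : ϖ ∉ I := fun h => hItop (by rw [Ideal.eq_top_iff_one]; exact hϖ 1 (by rw [mul_one]; exact h))
  have hϖm : ϖ ∈ maximalIdeal _ := by
    by_contra hu
    apply hne
    rw [Ideal.eq_top_iff_one]
    have hunit : IsUnit ϖ := by rwa [mem_maximalIdeal, mem_nonunits_iff, not_not] at hu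
    exact Ideal.mem_sup_right ((Ideal.span_singleton_eq_top.mpr hunit).symm ▸ Submodule.mem_top)
  -- a quasi-regular frame `c` of `I` and the stalk dictionary
  obtain ⟨n, c, -, hc, hq, -⟩ := exists_isQuasiRegular_span_eq_of_isRegularLocalRing_quotient (J := I) hIm (I : Set _) (Ideal.span_eq _)
  obtain ⟨j, 𝔔, χ, e, hχ, he, h𝔔⟩ :=
    exists_blowupAlgebra_stalk_ringEquiv_of_eq hτ y₂ c (Ideal.span (Set.range c)) rfl (hc.trans hIdef)
  letI := χ.toAlgebra
  haveI : IsLocalization.AtPrime (X₂.presheaf.stalk y₂) 𝔔.asIdeal := isLocalization_stalk_of_ringEquiv 𝔔 y₂ χ e he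
  have hεC := blowupAlgebraQuotEquiv_C c j hq
  -- the exceptional generator `w = c_j / 1`
  set w : X₂.presheaf.stalk y₂ := χ (algebraMap _ (blowupAlgebra (Ideal.span (Set.range c)) (c j)) (c j)) with hw
  have halg : algebraMap (blowupAlgebra (Ideal.span (Set.range c)) (c j)) (X₂.presheaf.stalk y₂) = χ := rfl
  have hφL : (algebraMap (blowupAlgebra (Ideal.span (Set.range c)) (c j)) (X₂.presheaf.stalk y₂)).comp
      (algebraMap (X.presheaf.stalk (τ y₂)) (blowupAlgebra (Ideal.span (Set.range c)) (c j))) = (τ.stalkMap y₂).hom :=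
    RingHom.ext fun a => hχ a
  have hKL : (Ideal.span {algebraMap (X.presheaf.stalk (τ y₂)) (blowupAlgebra (Ideal.span (Set.range c)) (c j)) (c j)}).map
      (algebraMap (blowupAlgebra (Ideal.span (Set.range c)) (c j)) (X₂.presheaf.stalk y₂)) = Ideal.span {w} := by
    rw [Ideal.map_span, Set.image_singleton]
    rfl
  have hE : stalkIdeal (𝒞.comap τ) y₂ = Ideal.span {w} := by
    rw [stalkIdeal_comap_eq_map_stalkMap, ← hIdef, ← hc, ← hφL, ← Ideal.map_map,
      map_blowupAlgebra_eq_span (Ideal.subset_span (Set.mem_range_self j)), Ideal.map_span, Set.image_singleton]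
    rfl
  have hImap : (Ideal.span (Set.range c)).map (τ.stalkMap y₂).hom ≤ Ideal.span {w} := by
    rw [hc, hIdef, ← stalkIdeal_comap_eq_map_stalkMap, hE]
  -- the ideal bookkeeping `K_L + (I + 𝔞)·R = (w) + 𝔞·R`
  have hsup : ∀ 𝔞 : Ideal (X.presheaf.stalk (τ y₂)),
      (Ideal.span {algebraMap (X.presheaf.stalk (τ y₂)) (blowupAlgebra (Ideal.span (Set.range c)) (c j)) (c j)}).map
          (algebraMap (blowupAlgebra (Ideal.span (Set.range c)) (c j)) (X₂.presheaf.stalk y₂)) ⊔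
        (Ideal.span (Set.range c) ⊔ 𝔞).map ((algebraMap (blowupAlgebra (Ideal.span (Set.range c)) (c j)) (X₂.presheaf.stalk y₂)).comp
          (algebraMap (X.presheaf.stalk (τ y₂)) (blowupAlgebra (Ideal.span (Set.range c)) (c j)))) =
      Ideal.span {w} ⊔ 𝔞.map (τ.stalkMap y₂).hom := by
    intro 𝔞
    rw [hKL, hφL, Ideal.map_sup, ← sup_assoc, sup_eq_left.mpr hImap]
  have hsupI : (Ideal.span {algebraMap (X.presheaf.stalk (τ y₂)) (blowupAlgebra (Ideal.span (Set.range c)) (c j)) (c j)}).map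
        (algebraMap (blowupAlgebra (Ideal.span (Set.range c)) (c j)) (X₂.presheaf.stalk y₂)) ⊔
      (Ideal.span (Set.range c)).map ((algebraMap (blowupAlgebra (Ideal.span (Set.range c)) (c j)) (X₂.presheaf.stalk y₂)).comp
        (algebraMap (X.presheaf.stalk (τ y₂)) (blowupAlgebra (Ideal.span (Set.range c)) (c j)))) = Ideal.span {w} := by
    have h := hsup ⊥
    simp only [sup_bot_eq, Ideal.map_bot] at h
    exact h
  -- `w` is a nonzerodivisor (the exceptional divisor is effective Cartier; `R` is a domain)
  have hw0 : w ≠ 0 := by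
    intro h0
    obtain ⟨u, hu, hKu⟩ := hτ.isEffectiveCartier.exists_stalkIdeal_eq_span y₂
    rw [hE, h0, Ideal.span_singleton_eq_bot.mpr rfl, eq_comm, Ideal.span_singleton_eq_bot] at hKu
    rw [hKu] at hu
    exact zero_notMem_nonZeroDivisors hu
  have hwreg : ∀ b : X₂.presheaf.stalk y₂, w * b = 0 → b = 0 := fun b hb =>
    (mul_eq_zero.mp hb).resolve_left hw0
  -- NONZERODIVISORS ASCEND (…NatCechShadowChartAlgebra):
  -- (A) `f*` regular mod `(w)`
  have hAf : ∀ z, (τ.stalkMap y₂).hom f * z ∈ Ideal.span {w} → z ∈ Ideal.span {w} := by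
    intro z hz
    have key := mem_sup_of_mul_mem_sup c j (algebraMap _ _) (blowupAlgebraQuotEquiv c j hq) hεC 𝔔.asIdeal (X₂.presheaf.stalk y₂)
      (Ideal.span (Set.range c)) le_rfl f (by rw [hc]; exact hfregI) z
    rw [hsupI, hφL] at key
    exact key hz
  -- (B) `f*` regular mod `(w) + (ϖ₂)`
  have hBf : ∀ z, (τ.stalkMap y₂).hom f * z ∈ Ideal.span {w} ⊔ Ideal.span {(τ.stalkMap y₂).hom ϖ} →
      z ∈ Ideal.span {w} ⊔ Ideal.span {(τ.stalkMap y₂).hom ϖ} := by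
    intro z hz
    have key := mem_sup_of_mul_mem_sup c j (algebraMap _ _) (blowupAlgebraQuotEquiv c j hq) hεC 𝔔.asIdeal (X₂.presheaf.stalk y₂)
      (Ideal.span (Set.range c) ⊔ Ideal.span {ϖ}) le_sup_left f (by rw [hc]; exact hG1) z
    rw [hsup (Ideal.span {ϖ}), hφL, Ideal.map_span, Set.image_singleton] at key
    exact key hz
  -- (C) `ϖ₂` regular mod `(w)`
  have hCϖ : ∀ z, (τ.stalkMap y₂).hom ϖ * z ∈ Ideal.span {w} → z ∈ Ideal.span {w} := by
    intro z hz
    have key := mem_sup_of_mul_mem_sup c j (algebraMap _ _) (blowupAlgebraQuotEquiv c j hq) hεC 𝔔.asIdeal (X₂.presheaf.stalk y₂)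
      (Ideal.span (Set.range c)) le_rfl ϖ (by rw [hc]; exact hϖ) z
    rw [hsupI, hφL] at key
    exact key hz
  -- the three swaps (…NatCechShadowRing / …ChartAlgebra)
  have hwf : ∀ z, w * z ∈ Ideal.span {(τ.stalkMap y₂).hom f} → z ∈ Ideal.span {(τ.stalkMap y₂).hom f} :=
    mul_mem_span_singleton_swap hwreg hAf
  have hwϖ : ∀ z, w * z ∈ Ideal.span {(τ.stalkMap y₂).hom ϖ} → z ∈ Ideal.span {(τ.stalkMap y₂).hom ϖ} :=
    mul_mem_span_singleton_swap hwreg hCϖ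
  refine ⟨w, hE, ?_, ?_, ?_, ?_⟩
  · -- (a) total transform = strict transform at `y₂`
    rw [stalkIdeal_strictTransformIdeal, hf, Ideal.map_span, Set.image_singleton, hE]
    exact iSup_colon_pow_eq_of_forall_mul_mem _ _ w rfl hwf
  · -- (b) `w` regular mod `(f*) + (ϖ₂)`
    intro z hz
    exact mul_mem_sup_of_swap (Ideal.span {(τ.stalkMap y₂).hom ϖ}) hwϖ hBf z hz
  · -- (c) `ϖ₂` regular mod `(w) + (f*)`
    intro z hz
    have hBf' : ∀ a, (τ.stalkMap y₂).hom f * a ∈ Ideal.span {(τ.stalkMap y₂).hom ϖ} ⊔ Ideal.span {w} →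
        a ∈ Ideal.span {(τ.stalkMap y₂).hom ϖ} ⊔ Ideal.span {w} := by
      intro a ha
      rw [sup_comm] at ha ⊢
      exact hBf a ha
    have h := mul_mem_sup_of_swap (Ideal.span {w}) hCϖ hBf' z (by rw [sup_comm]; exact hz)
    rw [sup_comm] at h
    exact h
  · -- (d) the `n = 3` conditional regularity
    intro hdim hfm hred
    -- reducedness DESCENDS to `A / (I + (ϖ) + (f))`
    obtain ⟨𝔞, h𝔞⟩ : ∃ 𝔞 : Ideal (X.presheaf.stalk (τ y₂)), 𝔞 = Ideal.span (Set.range c) ⊔ (Ideal.span {ϖ} ⊔ Ideal.span {f}) := ⟨_, rfl⟩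
    have hc𝔞 : Ideal.span (Set.range c) ≤ 𝔞 := by rw [h𝔞]; exact le_sup_left
    have h𝔞m : 𝔞 ≤ maximalIdeal _ := by
      rw [h𝔞, hc]
      exact sup_le hIm (sup_le ((Ideal.span_singleton_le_iff_mem _).mpr hϖm) ((Ideal.span_singleton_le_iff_mem _).mpr hfm))
    have h𝔞top : 𝔞 ≠ ⊤ := fun h => (maximalIdeal.isMaximal _).ne_top (top_le_iff.mp (h ▸ h𝔞m))
    have hmap𝔞 : (Ideal.span {ϖ} ⊔ Ideal.span {f}).map (τ.stalkMap y₂).hom =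
        Ideal.span {(τ.stalkMap y₂).hom ϖ} ⊔ Ideal.span {(τ.stalkMap y₂).hom f} := by
      rw [Ideal.map_sup, Ideal.map_span, Set.image_singleton, Ideal.map_span, Set.image_singleton]
    haveI : IsReduced (X₂.presheaf.stalk y₂ ⧸ ((Ideal.span {algebraMap (X.presheaf.stalk (τ y₂))
        (blowupAlgebra (Ideal.span (Set.range c)) (c j)) (c j)}).map
          (algebraMap (blowupAlgebra (Ideal.span (Set.range c)) (c j)) (X₂.presheaf.stalk y₂)) ⊔
        𝔞.map ((algebraMap (blowupAlgebra (Ideal.span (Set.range c)) (c j)) (X₂.presheaf.stalk y₂)).comp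
          (algebraMap (X.presheaf.stalk (τ y₂)) (blowupAlgebra (Ideal.span (Set.range c)) (c j)))))) := by
      have heq := hsup (Ideal.span {ϖ} ⊔ Ideal.span {f})
      rw [hmap𝔞, ← h𝔞] at heq
      exact isReduced_of_injective (Ideal.quotEquivOfEq heq).toRingHom (Ideal.quotEquivOfEq heq).injective
    have hredA : IsReduced (X.presheaf.stalk (τ y₂) ⧸ 𝔞) :=
      isReduced_quotient_of_isReduced c j (algebraMap _ _) (blowupAlgebraQuotEquiv c j hq) hεC 𝔔.asIdeal (X₂.presheaf.stalk y₂)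
        h𝔔 𝔞 hc𝔞 h𝔞top
    -- on `Abar = A / I`: the images `ϖ̄`, `f̄`
    set Abar := X.presheaf.stalk (τ y₂) ⧸ I with hAbar
    haveI : Nontrivial Abar := Ideal.Quotient.nontrivial_iff.mpr hItop
    haveI : IsLocalRing Abar := isLocalRing_quotient hItop
    have hmaxAb : maximalIdeal Abar = (maximalIdeal _).map (Ideal.Quotient.mk I) := maximalIdeal_quotient_eq_map I
    have hpib : Ideal.Quotient.mk I ϖ ∈ maximalIdeal Abar := by rw [hmaxAb]; exact Ideal.mem_map_of_mem _ hϖm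
    have hfb : Ideal.Quotient.mk I f ∈ maximalIdeal Abar := by rw [hmaxAb]; exact Ideal.mem_map_of_mem _ hfm
    have hpib0 : Ideal.Quotient.mk I ϖ ≠ 0 := fun h => hϖI (Ideal.Quotient.eq_zero_iff_mem.mp h)
    have hregb : ∀ z : Abar, Ideal.Quotient.mk I f * z ∈ Ideal.span {Ideal.Quotient.mk I ϖ} → z ∈ Ideal.span {Ideal.Quotient.mk I ϖ} := by
      intro z hz
      obtain ⟨a, rfl⟩ := Ideal.Quotient.mk_surjective z
      have hspan : Ideal.span {Ideal.Quotient.mk I ϖ} = (Ideal.span {ϖ}).map (Ideal.Quotient.mk I) := by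
        rw [Ideal.map_span, Set.image_singleton]
      rw [hspan, ← map_mul, Ideal.mem_quotient_iff_mem_sup, sup_comm] at hz
      rw [hspan, Ideal.mem_quotient_iff_mem_sup, sup_comm]
      exact hG1 a hz
    -- `Abar / ((ϖ̄) + (f̄)) ≅ A / 𝔞` is reduced
    have h𝔞' : 𝔞 = I ⊔ (Ideal.span {ϖ} ⊔ Ideal.span {f}) := by rw [h𝔞, hc]
    have hmapI : (Ideal.span {ϖ} ⊔ Ideal.span {f}).map (Ideal.Quotient.mk I) =
        Ideal.span {Ideal.Quotient.mk I ϖ} ⊔ Ideal.span {Ideal.Quotient.mk I f} := by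
      rw [Ideal.map_sup, Ideal.map_span, Set.image_singleton, Ideal.map_span, Set.image_singleton]
    let eq : Abar ⧸ (Ideal.span {Ideal.Quotient.mk I ϖ} ⊔ Ideal.span {Ideal.Quotient.mk I f}) ≃+* X.presheaf.stalk (τ y₂) ⧸ 𝔞 :=
      ((Ideal.quotEquivOfEq hmapI).symm.trans (DoubleQuot.quotQuotEquivQuotSup I _)).trans (Ideal.quotEquivOfEq h𝔞'.symm)
    haveI : IsReduced (Abar ⧸ (Ideal.span {Ideal.Quotient.mk I ϖ} ⊔ Ideal.span {Ideal.Quotient.mk I f})) :=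
      isReduced_of_injective eq.toRingHom eq.injective
    -- the ring lemma: `Abar / (f̄)` is regular local
    obtain ⟨-, -, hregq⟩ := isRegularLocalRing_quotient_span_of_isReduced (S := Abar) hdim _ _ hpib hpib0 hfb hregb
    -- hence `A / (I + (f))` is a regular ring, and REGULARITY ASCENDS
    obtain ⟨𝔞', h𝔞'def⟩ : ∃ 𝔞' : Ideal (X.presheaf.stalk (τ y₂)), 𝔞' = Ideal.span (Set.range c) ⊔ Ideal.span {f} := ⟨_, rfl⟩
    have h𝔞'le : 𝔞' ≤ 𝔞 := by rw [h𝔞'def, h𝔞]; exact sup_le_sup_left le_sup_right _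
    have h𝔞'top : 𝔞' ≠ ⊤ := fun h => h𝔞top (top_le_iff.mp (h ▸ h𝔞'le))
    have hmapI' : (Ideal.span {f}).map (Ideal.Quotient.mk I) = Ideal.span {Ideal.Quotient.mk I f} := by
      rw [Ideal.map_span, Set.image_singleton]
    have h𝔞'I : I ⊔ Ideal.span {f} = 𝔞' := by rw [h𝔞'def, hc]
    let eq' : Abar ⧸ Ideal.span {Ideal.Quotient.mk I f} ≃+* X.presheaf.stalk (τ y₂) ⧸ 𝔞' :=
      ((Ideal.quotEquivOfEq hmapI').symm.trans (DoubleQuot.quotQuotEquivQuotSup I _)).trans (Ideal.quotEquivOfEq h𝔞'I)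
    haveI : IsRegularRing (X.presheaf.stalk (τ y₂) ⧸ 𝔞') := by
      haveI := hregq
      haveI := isRegularRing_of_isRegularLocalRing (Abar ⧸ Ideal.span {Ideal.Quotient.mk I f})
      exact IsRegularRing.of_ringEquiv eq'
    have hfin := isRegularLocalRing_quotient_sup_of_isRegularRing c j (algebraMap _ _) (blowupAlgebraQuotEquiv c j hq) hεC 𝔔.asIdeal
      (X₂.presheaf.stalk y₂) h𝔔 𝔞' (by rw [h𝔞'def]; exact le_sup_left) h𝔞'top
    have hmapf : (Ideal.span {f}).map (τ.stalkMap y₂).hom = Ideal.span {(τ.stalkMap y₂).hom f} := by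
      rw [Ideal.map_span, Set.image_singleton]
    have heq' := hsup (Ideal.span {f})
    rw [hmapf, ← h𝔞'def] at heq'
    rw [heq'] at hfin
    exact hfin

end Summit.ResolutionOfSingularities.ResolutionOfSingularities.Cruxes.EquisingularLiftNat.Sections.CechShadow

end
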